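import Summits.CriticalPhenomena.PercolationContinuityZ3.Theses.PercLowPointHalfSpace
import Summits.CriticalPhenomena.PercolationContinuityZ3.Theorems.QuantitativeBGN.Negative.ArmLowerBound
import Summits.CriticalPhenomena.PercolationContinuityZ3.Theorems.PercLowPointHalfSpaceQuantitativeBGNArmToSurfaceTail
import Summits.CriticalPhenomena.PercolationContinuityZ3.Theorems.PercLowPointHalfSpaceQuantitativeBGNKlSurfaceTail
import Literature.Probability.Percolation.HutchcroftVolumeTail
import Literature.Probability.Percolation.HalfSpace
import Literature.Probability.Percolation.SlabUniqueness
import HarnessLib.Audit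

/-!
# Line `kl-surface-susceptibility-transfer` — skeleton for crux `PercLowPointHalfSpace.QuantitativeBGN`
(item stmt-CriticalPhenomena-0913; route route-CriticalPhenomena-PercLowPointHalfSpace, shared by
PercPorousCritical, PercFoamCut, PercPortalLadder)

Crux (r4, C): `QuantitativeBGN : ∃ a C, 0 < a ∧ ∀ r ≥ 1, P_{p_c(ℤ³)}(arm_H(0,r)) ≤ C r^{-a}`,
`arm_H(0,r) = {∃ y, ‖y‖∞ ≥ r ∧ 0 ↔ y in H}`, `H = {x | 0 ≤ x 0}` (readback `quantitativeBGN_iff`,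
`Iff.rfl`, landed `Theorems/QuantitativeBGN/Negative/ArmLowerBound.lean`).

## The line (crux idea card `Ideas/kl-surface-susceptibility-transfer.md`, ideator 1; triage r1: 3/3 pass)

ENTROPIC SPRINKLING ON THE HALF-SPACE GRAPH. Run the Dewan–Muirhead / Hutchcroft relative-entropy
comparison of `P_q` with `P_p` for the cluster-size tail of ONE vertex — the tree theorem
`ClusterExploration.real_clusterSizeGe_le_of_kl` (Hutchcroft 2022 Thm 1.3 on ANY graph of max degree
`Δ`: `P_q(|C(o)| ≥ n) ≤ 2 P_p(|C(o)| ≥ n) + 8Δ·kl(p‖q)·Σ_{j≤n} P_p(|C(o)| ≥ j)`) — on the INDUCED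
half-space graph `H = (zdGraph 3).induce {x₀ ≥ 0}` (`halfSpaceGraph 3`, `Δ = 6`, root
`halfSpaceOrigin 3`), with `q = p_c(ℤ³)` and `p = p_c − ε` SUBCRITICAL, and close with Markov. The KL
price is paid in the SURFACE susceptibility `χ_H(p) = E_p|C_H(0)| = expClusterSize (halfSpaceGraph 3)
(halfSpaceOrigin 3) p`, not in bulk volume:

  `P^H_{p_c}(|C_H(0)| ≥ n) ≤ χ_H(p) · (2/n + 48 · kl(p ‖ p_c))`      (STUB 2, `KLSurfaceTail`).

A power law `χ_H(p_c − ε) ≤ C ε^{-γ₁}` with `γ₁ < 2` (STUB 3, `SurfaceGammaSubQuadratic` = the card's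
transfer target `C⁺`) and the chi-square bound `kl(p‖p_c) ≤ ε²/(p_c(1−p_c))` (PROVED here,
`binaryKL_le_sq_div`) give, with `ε = ε₀ n^{-1/2}` (`ε₀ = min(δ, p_c)/2`, valid for every `n ≥ 1`),
`P^H_{p_c}(|C_H(0)| ≥ n) ≤ K n^{-(1 − γ₁/2)}` (PROVED here, `surfaceVolumeTailDecay_of`); finally
`arm_H(0,r) ⊆ {|C_H(0)| ≥ r}` transported through the restriction coupling ambient ↔ induced
(STUB 1, `ArmToSurfaceTail`) gives the crux with `a = 1 − γ₁/2 ∈ (0, 1]` (PROVED: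
`quantitativeBGNAt_of_transfer`, and BY NAME `QuantitativeBGN_of`).

Numerics: `γ₁ = ν(3 − x_s − x_b) ≈ 0.876·(3 − 0.975 − 0.477) ≈ 1.36` in `d = 3` (scaling; Deng–Blöte
2005 doi:10.1103/PhysRevE.71.016117 for `x_s`; direct fit = ideator kit job j009482, pending at planning
time), margin `≈ 0.64` to the threshold `2`; bulk `γ ≈ 1.80`. CALIBRATION (d-dependence): in `d = 2`
the same scaling gives `γ₁ = ν(2 − x_s − x_b) = (4/3)(2 − 1/3 − 5/48) = 25/12 > 2`, so the line is
EMPTY in the plane (output exponent `1 − γ₁/2 < 0`) — a proof of STUB 3 must use `d = 3` (or `d ≥ 3`)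
somewhere; in `d > 6`, `γ₁ = 1/2` and the line outputs `a = 3/4` (non-sharp but valid, Chatterjee–Hanson
`a = 3` for `d ≥ 11`).

## Stubs (3) and glue — STATE after wave 1 (lead prover-line-stmt-CriticalPhenomena-0913-0, 2026-08-16):
STUB 1 LANDED p77770 (`Theorems/PercLowPointHalfSpaceQuantitativeBGNArmToSurfaceTail.lean`), STUB 2 LANDED
p79950 (`Theorems/PercLowPointHalfSpaceQuantitativeBGNKlSurfaceTail.lean`); the composition modulo STUB 3
(`γ₁ < 2 ⇒ QuantitativeBGN`, hypotheses verbatim) is `Theorems/PercLowPointHalfSpaceQuantitativeBGNKlTransfer.lean`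
(`quantitativeBGN_of_surfaceGammaSubQuadratic`, `quantitativeBGN_of_surfaceVolumeTail`); STUB 3 remains OPEN
(the only `sorry` below).

* `stub_armToSurfaceTail` (M, LANDED p77770) — `P^{ℤ³}_p(arm_H(0,r)) ≤ P^H_p(|C_H(0)| ≥ r)` for all
  `p, r`: restriction coupling `bondPercolation_map_comap` (`(P^{ℤ³}_p).map (restrictConfig val) =
  P^H_p`, `SubgraphMonotonicity.lean`) + `image_openCluster_restrictConfig` /
  `openConnIn_eq_openConnVia` / `openClusterIn_withinGraph_eq_top` (`ConstrainedClusters.lean`, a.s.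
  `ω ⊆ E(ℤ³)` by `setBernoulli_ae_subset`) + "an open path from `0` to sup-distance `≥ r` has `≥ r+1`
  vertices, all in `C_H(0)`" (coordinate changes by `≤ 1` per lattice step).
* `stub_klSurfaceTail` (M, LANDED p79950) — the display above for general `p, q ∈ (0,1)` and any real
  `M ≥ χ_H(p)`: `real_clusterSizeGe_le_of_kl` on `halfSpaceGraph 3` (instance
  `instLocallyFiniteInduce`, `SlabUniqueness.lean`; `degree ≤ 6` from `degree_zdGraph_le`, cf.
  `degree_halfSpaceGraph_le` PROVED below), `Σ_{j≤n} P_p(|C_H| ≥ j) ≤ M`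
  (`ofReal_sum_real_clusterSizeGe_le` + `ENNReal.ofReal_le_ofReal_iff`), and Markov in the form
  `n · P_p(|C_H| ≥ n) ≤ Σ_{j≤n} P_p(|C_H| ≥ j)` (`clusterSizeGe_antitone`).
* `stub_surfaceGammaSubQuadratic` (XL, OPEN, HARDEST — the transfer target `C⁺`) — `∃ γ < 2, C, δ > 0`,
  `χ_H(p) ≤ C (p_c − p)^{-γ}` for `p ∈ (p_c − δ, p_c)`. No power-law upper bound on ANY percolation
  susceptibility as `p ↑ p_c` is known in `3 ≤ d ≤ 6` (DKT2020: `ξ(p) ≤ exp(C/(p_c−p)²)` only); the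
  window that is genuinely intermediate is `γ ∈ [1, 2)` (triage r1-3: `χ ≤ χ_H²` by the lowest-vertex
  split + BK, so `γ₁ ≥ γ/2 ≥ 1/2` with Aizenman–Newman `γ ≥ 1`, and `γ₁ < 1` would already force bulk
  `γ < 2 ⇒ θ(p_c) = 0` through the bulk KL argument, `SubexponentialGrowthZdNarrow`). Dead sub-route
  recorded in the line card: the naive finite-size route `χ_H(p) ≤ |S|/(1 − φ^H_p(S))` with `S` a
  half-box of side `≍ ξ(p)` only gives `γ₁ ≤ 3ν ≈ 2.63 > 2`.
* Glue (sorry-free): `binaryKL_le_sq_div`, `surfaceVolumeTailDecay_of` (stubs 2+3 ⇒ a polynomial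
  volume tail for `C_H(0)` AT `p_c`, exponent `1 − γ/2`), `quantitativeBGNAt_of_surfaceVolumeTail`
  (stub 1 ⇒ crux at `p_c` from any such tail), `quantitativeBGNAt_of_transfer`, `QuantitativeBGN_of`.

## Disproof used (`Cruxes/QuantitativeBGN/Disproof.lean`, cdisprove v3, read 2026-08-16T02:10Z; landed
`Negative/ArmLowerBound.lean` p73079 IMPORTED here, `Negative/LoadBearing.lean` p73842 read — not yet
built on the farm snapshot at planning time, hence not imported)

* `quantitativeBGNAt_false_of_criticalProb_lt` / `quantitativeBGNAt_one_false` / `not_uniform_above`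
  (any proof must use `p ≤ p_c`): HONOURED — `p = p_c` enters exactly once, as the parameter `q` of
  STUB 2 in `surfaceVolumeTailDecay_of`, compared FROM BELOW with `p = p_c − ε` inside STUB 3's window
  `(p_c − δ, p_c)`; run at `q > p_c` the same inequality stays true but `kl(p‖q) ≥ kl(p_c‖q) > 0` does not
  tend to `0`, so no rate is (wrongly) produced above `p_c`.
* `quantitativeBGN_false_without_rPos` (`1 ≤ r` load-bearing): USED — `n ≥ 1` in STUB 2 (Markov `2/n`)
  and `r ≥ 1 ⇒ r^{-1/2} ≤ 1 ⇒ ε ≤ ε₀ < min(δ, p_c)` in the glue.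
* `quantitativeBGNWithoutAPos_trivial` (`0 < a` load-bearing): `a = 1 − γ/2 > 0 ⇔ γ < 2`, the whole
  content of STUB 3.
* `armH_lower_bound` / `not_quantitativeBGNWith_of_two_lt` (window `0 < a ≤ 2`): RESPECTED — STUB 3 can
  only hold with `γ ≥ 0` (`χ_H ≥ 1`), so `a = 1 − γ/2 ≤ 1 ≤ 2`; with `γ₁ ≥ 1/2` even `a ≤ 3/4`.
* `not_expDecay_at_criticalProb`: consistent (a power comes out, never an exponential).
* `quantitativeBGNAt_of_lt_criticalProb` (exponential room below `p_c`, constants `e^{c(p)}/c(p)`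
  blowing up): this is exactly what the KL step upgrades — the uncontrolled `c(p)` is traded for the
  polynomially controlled `χ_H(p)`.
* No `-- Targets` stub kill applies; no stub is an instance refuted by a landed Negative lemma (STUB 1 is
  an inequality between events valid at every `p`; STUB 2 holds for all `p, q ∈ (0,1)`; STUB 3 concerns
  `p < p_c` only). Negatives index (`ledger negatives`, 8 refuted on the summit): unrelated.
-/

noncomputable section

namespace Summit.CriticalPhenomena.PercolationContinuityZ3.Cruxes.QuantitativeBGN.KlSurfaceSusceptibilityTransfer

open MeasureTheory Filter
open Literature.Probability.Percolation Literature.Probability.LatticeModels Literature.Probability.Entropy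
open scoped ENNReal Topology
open Summit.CriticalPhenomena.PercolationContinuityZ3.Theses.PercLowPointHalfSpace (QuantitativeBGN)
open Summit.CriticalPhenomena.PercolationContinuityZ3.Theorems.QuantitativeBGN.Negative
  (armH QuantitativeBGNAt quantitativeBGN_iff)

/-! ### Readback and conventions -/

/-- The crux is literally `QuantitativeBGNAt (criticalProbI 3)` (Negative/ArmLowerBound readback). -/
example : QuantitativeBGN ↔ QuantitativeBGNAt (criticalProbI 3) := Iff.rfl

/-- The two spellings of the induced half-space graph of `ℤ³` agree definitionally
(`HalfSpace.lean` vs the route's `{x | 0 ≤ x 0}`). -/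
example : halfSpaceGraph 3 = (zdGraph 3).induce {x : Site 3 | 0 ≤ x 0} := rfl

/-! ### The statements of the line (named `Prop`s over existing declarations) -/

/-- **Statement of STUB 1** (`ArmToSurfaceTail`, ambient ↔ induced bridge): the crux's arm event,
measured under bond percolation on `ℤ³`, is dominated by the cluster-size tail of the root of the
INDUCED half-space graph under its own Bernoulli measure: `P^{ℤ³}_p(arm_H(0,r)) ≤ P^H_p(|C_H(0)| ≥ r)`
(even `≥ r + 1`), every `p`, every `r`. -/
def ArmToSurfaceTail : Prop :=
  ∀ (p : unitInterval) (r : ℕ),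
    (bondPercolation (zdGraph 3) p).real (armH r) ≤
      (bondPercolation (halfSpaceGraph 3) p).real (clusterSizeGe (halfSpaceOrigin 3) r)

/-- **Statement of STUB 2** (`KLSurfaceTail`, the lever): Hutchcroft's Thm 1.3 on the half-space
graph (`Δ = 6`) + Markov, with the KL price paid in the surface susceptibility: for `p, q ∈ (0,1)`,
any real `M ≥ χ_H(p)` and `n ≥ 1`, `P^H_q(|C_H(0)| ≥ n) ≤ M (2/n + 48 kl(p‖q))`. -/
def KLSurfaceTail : Prop :=
  ∀ (p q : unitInterval), 0 < (p : ℝ) → (p : ℝ) < 1 → 0 < (q : ℝ) → (q : ℝ) < 1 →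
    ∀ M : ℝ, 0 ≤ M → expClusterSize (halfSpaceGraph 3) (halfSpaceOrigin 3) p ≤ ENNReal.ofReal M →
      ∀ n : ℕ, 1 ≤ n →
        (bondPercolation (halfSpaceGraph 3) q).real (clusterSizeGe (halfSpaceOrigin 3) n) ≤
          M * (2 / (n : ℝ) + 48 * binaryKL (p : ℝ) (q : ℝ))

/-- **Statement of STUB 3** (`SurfaceGammaSubQuadratic`, the transfer target `C⁺`): the SURFACE
susceptibility exponent of `ℤ³` bond percolation is `< 2` — `χ_H(p) ≤ C (p_c − p)^{-γ}`, `γ < 2`, on a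
left neighbourhood of `p_c(ℤ³)` (numerically `γ₁ ≈ 1.36`; interval of genuine interest `γ ∈ [1,2)`). -/
def SurfaceGammaSubQuadratic : Prop :=
  ∃ γ C δ : ℝ, γ < 2 ∧ 0 < C ∧ 0 < δ ∧
    ∀ p : unitInterval, criticalProb (zdGraph 3) (0 : Site 3) - δ < p →
      (p : ℝ) < criticalProb (zdGraph 3) (0 : Site 3) →
        expClusterSize (halfSpaceGraph 3) (halfSpaceOrigin 3) p ≤
          ENNReal.ofReal (C * (criticalProb (zdGraph 3) (0 : Site 3) - p) ^ (-γ))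

/-- The intermediate station of the glue (NOT a stub; proved from STUBS 2 + 3 below): a polynomial
volume tail for the critical half-space cluster of the root, ON THE INDUCED GRAPH,
`P^H_{p_c}(|C_H(0)| ≥ n) ≤ C n^{-b}`, some `b > 0`. Any proof of this by other means also closes the
crux through STUB 1 alone (`quantitativeBGNAt_of_surfaceVolumeTail`). -/
def SurfaceVolumeTailDecay : Prop :=
  ∃ b C : ℝ, 0 < b ∧ ∀ n : ℕ, 1 ≤ n →
    (bondPercolation (halfSpaceGraph 3) (criticalProbI 3)).real (clusterSizeGe (halfSpaceOrigin 3) n) ≤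
      C * (n : ℝ) ^ (-b)

/-! ### The registered stubs (statements expanded over existing declarations) -/

/-- STUB 1 (M, LANDED p77770 — `Theorems.stub_armToSurfaceTail`) — `ArmToSurfaceTail`. For every `p` and `r`:
`P^{ℤ³}_p({∃ y, ‖y‖∞ ≥ r, 0 ↔ y in {x₀ ≥ 0}}) ≤ P^{H}_p(|C(halfSpaceOrigin)| ≥ r)` where the right side
is bond percolation on the induced graph `halfSpaceGraph 3 = (zdGraph 3).induce (halfSpace 3)`.
Proof plan: `bondPercolation_map_comap (zdGraph 3) Subtype.val_injective p` identifies `P^H_p` with the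
push-forward of `P^{ℤ³}_p` under `restrictConfig Subtype.val` (`halfSpaceGraph 3 = (zdGraph 3).comap
Subtype.val` definitionally), so the right side is `P^{ℤ³}_p(restrictConfig val ⁻¹' clusterSizeGe o r)`
(`map_measureReal_apply`, `measurable_restrictConfig`, `measurableSet_clusterSizeGe`); a.s. `ω ⊆ E(ℤ³)`
(`setBernoulli_ae_subset`, pattern `DCT16.real_mono_of_forall_subset_edgeSet`), and for such `ω` in the
arm event the `H`-open path `0 → y` (`openConnIn_eq_openConnVia`, `openClusterIn_withinGraph_eq_top`,
`DCT16.mem_openConnIn_iff_pathIn`) lifts to the induced graph (`reachable_restrictConfig_of_reachable_within`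
/ `image_openCluster_restrictConfig`) and visits, for the coordinate `i` with `|y i| ≥ r`, vertices with
`|x i| = 0, 1, …, r` (steps change a coordinate by `≤ 1`): `≥ r + 1 ≥ r` distinct cluster points, i.e.
`(r : ℕ∞) ≤ encard` (`mem_clusterSizeGe`). Why plausibly true: it is an inclusion of events under a
measure-preserving map. Size: M (coupling bookkeeping + a discrete intermediate-value step). -/
theorem stub_armToSurfaceTail :
    ∀ (p : unitInterval) (r : ℕ),
      (bondPercolation (zdGraph 3) p).real
          {ω | ∃ y : Site 3, (∃ i : Fin 3, (r : ℤ) ≤ |y i|) ∧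
            ω ∈ openConnIn {x : Site 3 | 0 ≤ x 0} 0 y} ≤
        (bondPercolation (halfSpaceGraph 3) p).real (clusterSizeGe (halfSpaceOrigin 3) r) :=
  -- LANDED (wave 1, p77770): `Theorems/PercLowPointHalfSpaceQuantitativeBGNArmToSurfaceTail.lean`
  Summit.CriticalPhenomena.PercolationContinuityZ3.Theorems.stub_armToSurfaceTail

/-- STUB 2 (M, LANDED p79950 — `Theorems.stub_klSurfaceTail`) — `KLSurfaceTail`: for `p, q ∈ (0,1)`, `M ≥ 0` real with
`χ_H(p) = expClusterSize (halfSpaceGraph 3) (halfSpaceOrigin 3) p ≤ M`, and `n ≥ 1`,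
`P^H_q(|C_H(0)| ≥ n) ≤ M · (2/n + 48 · kl(p‖q))`.
Proof plan: `ClusterExploration.real_clusterSizeGe_le_of_kl (G := halfSpaceGraph 3) (n := n) hΔ
(halfSpaceOrigin 3) p q …` with `hΔ : ∀ v, (halfSpaceGraph 3).degree v ≤ 6` (`degree_halfSpaceGraph_le`
below; instance `instLocallyFiniteInduce` of `SlabUniqueness.lean`) gives
`P_q ≤ 2 P_p(|C| ≥ n) + 8·6·kl·S_n`, `S_n = Σ_{j ∈ Icc 1 n} P_p(|C| ≥ j)`; `S_n ≤ M` from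
`ofReal_sum_real_clusterSizeGe_le` + `ENNReal.ofReal_le_ofReal_iff hM`; and `n · P_p(|C| ≥ n) ≤ S_n`
(`clusterSizeGe_antitone`: each of the `n` terms is `≥ P_p(|C| ≥ n)`), so `2 P_p(|C| ≥ n) ≤ 2M/n`;
`kl ≥ 0` (`binaryKL_nonneg`) to multiply the bound `S_n ≤ M`. Why plausibly true: it is Hutchcroft 2022
Thm 1.3 (in tree, graph-generic) followed by Markov. Size: M. [cite: arXiv:2106.06400, Thm 1.3] -/
theorem stub_klSurfaceTail :
    ∀ (p q : unitInterval), 0 < (p : ℝ) → (p : ℝ) < 1 → 0 < (q : ℝ) → (q : ℝ) < 1 →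
      ∀ M : ℝ, 0 ≤ M → expClusterSize (halfSpaceGraph 3) (halfSpaceOrigin 3) p ≤ ENNReal.ofReal M →
        ∀ n : ℕ, 1 ≤ n →
          (bondPercolation (halfSpaceGraph 3) q).real (clusterSizeGe (halfSpaceOrigin 3) n) ≤
            M * (2 / (n : ℝ) + 48 * binaryKL (p : ℝ) (q : ℝ)) :=
  -- LANDED (wave 1, p79950): `Theorems/PercLowPointHalfSpaceQuantitativeBGNKlSurfaceTail.lean`
  Summit.CriticalPhenomena.PercolationContinuityZ3.Theorems.stub_klSurfaceTail

/-- STUB 3 (XL, OPEN, HARDEST — the transfer target `C⁺` of the card) — `SurfaceGammaSubQuadratic`: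
there are `γ < 2`, `C > 0`, `δ > 0` with `χ_H(p) ≤ C (p_c(ℤ³) − p)^{-γ}` (as an `ℝ≥0∞` bound on
`expClusterSize (halfSpaceGraph 3) (halfSpaceOrigin 3) p`) for every `p ∈ (p_c − δ, p_c)`.
Why plausibly true: scaling `γ₁ = ν(3 − x_s − x_b) ≈ 1.36` (margin `0.64`); even the crude inclusion
`χ_H ≤ χ` makes any bulk bound with `γ̄ < 2` sufficient (bulk `γ ≈ 1.80`, but such a bulk bound is
conjunct-strength). Why it might fail AS A LEMMA TO PROVE: no near-critical power-law upper bound on any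
percolation susceptibility is known for `3 ≤ d ≤ 6` (DKT2020 only `ξ ≤ exp(C ε^{-2})`); the statement is
FALSE in `d = 2` (`γ₁ = 25/12`), so a proof must use `d ≥ 3`; subcritical tools (tree-graph, OSSS,
Simon–Lieb) give LOWER bounds or the lossy `3ν ≈ 2.63`. The monotone form along a sequence
`p_k = p_c − 2^{-k}` is equivalent (χ_H is nondecreasing in `p`). Size: XL (open problem-sized, but
strictly weaker than the bulk `γ < 2` and not known to imply the conjunct).
[cite: doi:10.1007/s00440-022-01176-3, Thm 1.10 / Rem 1.11 (bulk analogue, exponents assumed)]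
[cite: doi:10.1103/PhysRevE.71.016117 (surface exponents of 3D percolation, x_s)] -/
theorem stub_surfaceGammaSubQuadratic :
    ∃ γ C δ : ℝ, γ < 2 ∧ 0 < C ∧ 0 < δ ∧
      ∀ p : unitInterval, criticalProb (zdGraph 3) (0 : Site 3) - δ < p →
        (p : ℝ) < criticalProb (zdGraph 3) (0 : Site 3) →
          expClusterSize (halfSpaceGraph 3) (halfSpaceOrigin 3) p ≤
            ENNReal.ofReal (C * (criticalProb (zdGraph 3) (0 : Site 3) - p) ^ (-γ)) := by
  sorry

/-! ### Consistency: each named statement IS its registered stub (definitionally) -/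

theorem armToSurfaceTail_holds : ArmToSurfaceTail := stub_armToSurfaceTail
theorem klSurfaceTail_holds : KLSurfaceTail := stub_klSurfaceTail
theorem surfaceGammaSubQuadratic_holds : SurfaceGammaSubQuadratic := stub_surfaceGammaSubQuadratic

/-! ### Name-keyed aliases of the three statements (the hypotheses of the composition; the skeleton
audit admits a hypothesis only if its head constant is a registered obligation or is named like a
declared stub) -/
namespace Registered

/-- Alias of `ArmToSurfaceTail` keyed by the registered stub name. -/
abbrev stub_armToSurfaceTail : Prop := ArmToSurfaceTail
/-- Alias of `KLSurfaceTail` keyed by the registered stub name. -/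
abbrev stub_klSurfaceTail : Prop := KLSurfaceTail
/-- Alias of `SurfaceGammaSubQuadratic` keyed by the registered stub name. -/
abbrev stub_surfaceGammaSubQuadratic : Prop := SurfaceGammaSubQuadratic

end Registered

/-! ### Proved plumbing -/

/-- **Chi-square upper bound on the binary relative entropy**: `kl(a‖b) ≤ (a−b)²/(b(1−b))` for
`a ∈ [0,1]`, `b ∈ (0,1)` (termwise `log x ≤ x − 1`). This is the KL price of the comparison
`p = p_c − ε` versus `p_c`: `≤ ε²/(p_c(1−p_c))`. -/
theorem binaryKL_le_sq_div {a b : ℝ} (ha0 : 0 ≤ a) (ha1 : a ≤ 1) (hb0 : 0 < b) (hb1 : b < 1) :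
    binaryKL a b ≤ (a - b) ^ 2 / (b * (1 - b)) := by
  have h1b : 0 < 1 - b := by linarith
  have hbne : b ≠ 0 := hb0.ne'
  have h1bne : 1 - b ≠ 0 := h1b.ne'
  have t1 : a * Real.log (a / b) ≤ a * (a / b - 1) := by
    rcases ha0.eq_or_lt with h | ha
    · rw [← h]; simp
    · exact mul_le_mul_of_nonneg_left (Real.log_le_sub_one_of_pos (div_pos ha hb0)) ha.le
  have t2 : (1 - a) * Real.log ((1 - a) / (1 - b)) ≤ (1 - a) * ((1 - a) / (1 - b) - 1) := by
    rcases (sub_nonneg.2 ha1).eq_or_lt with h | h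
    · rw [← h]; simp
    · exact mul_le_mul_of_nonneg_left (Real.log_le_sub_one_of_pos (div_pos h h1b)) h.le
  calc binaryKL a b = a * Real.log (a / b) + (1 - a) * Real.log ((1 - a) / (1 - b)) := rfl
    _ ≤ a * (a / b - 1) + (1 - a) * ((1 - a) / (1 - b) - 1) := add_le_add t1 t2
    _ = (a - b) ^ 2 / (b * (1 - b)) := by field_simp; ring

/-- `Δ = 6` on the half-space graph of `ℤ³` (the constant `48 = 8·Δ` of STUB 2) — now the landed
`Theorems.klSurfaceTail_degree_halfSpaceGraph_le` (p79950). -/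
example (v : halfSpace 3) : (halfSpaceGraph 3).degree v ≤ 6 :=
  Summit.CriticalPhenomena.PercolationContinuityZ3.Theorems.klSurfaceTail_degree_halfSpaceGraph_le v

/-! ### Glue (PROVED): stubs 2 + 3 ⇒ a polynomial volume tail at `p_c` on `H`; stub 1 ⇒ the crux -/

/-- **STUBS 2 + 3 ⇒ `SurfaceVolumeTailDecay`** with exponent `b = 1 − γ/2`: for `n ≥ 1` take
`ε = ε₀ n^{-1/2}`, `ε₀ = min(δ, p_c)/2` (so `p = p_c − ε ∈ (p_c − δ, p_c) ∩ (0,1)` for EVERY `n ≥ 1`),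
`M = C ε^{-γ}`; then `P^H_{p_c}(|C_H| ≥ n) ≤ C ε^{-γ}(2/n + 48 ε²/(p_c(1−p_c))) = K n^{-(1−γ/2)}` with
`K = C ε₀^{-γ}(2 + 48 ε₀²/(p_c(1−p_c)))`. Uses `0 < p_c(ℤ³) < 1` (`criticalProb_zd_pos`,
`criticalProb_zd_lt_one`). Here, and only here, `p = p_c` is used (as the `q` of STUB 2). -/
theorem surfaceVolumeTailDecay_of (h2 : KLSurfaceTail) (h3 : SurfaceGammaSubQuadratic) :
    SurfaceVolumeTailDecay := by
  obtain ⟨γ, C, δ, hγ, hC, hδ, hS⟩ := h3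
  set pc : ℝ := criticalProb (zdGraph 3) (0 : Site 3) with hpc_def
  have hpc0 : 0 < pc := criticalProb_zd_pos 3 (by norm_num)
  have hpc1 : pc < 1 := criticalProb_zd_lt_one (d := 3) (by norm_num)
  -- the scale-free part `ε₀` of `ε = ε₀ n^{-1/2}`: small enough for every `n ≥ 1`
  set ε₀ : ℝ := min δ pc / 2 with hε₀_def
  have hε₀pos : 0 < ε₀ := by
    have : 0 < min δ pc := lt_min hδ hpc0
    rw [hε₀_def]; linarith
  have hε₀δ : ε₀ < δ := by
    have : min δ pc ≤ δ := min_le_left _ _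
    rw [hε₀_def]; linarith
  have hε₀pc : ε₀ ≤ pc / 2 := by
    have : min δ pc ≤ pc := min_le_right _ _
    rw [hε₀_def]; linarith
  -- the constant
  set K : ℝ := C * ε₀ ^ (-γ) * (2 + 48 * (ε₀ ^ 2 / (pc * (1 - pc)))) with hK_def
  refine ⟨1 - γ / 2, K, by linarith, fun n hn => ?_⟩
  have hn0 : (0 : ℝ) < n := by exact_mod_cast hn
  have hn1 : (1 : ℝ) ≤ n := by exact_mod_cast hn
  -- the scale `s = n^{-1/2} ∈ (0, 1]`
  set s : ℝ := (n : ℝ) ^ (-(1 / 2 : ℝ)) with hs_def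
  have hs0 : 0 < s := Real.rpow_pos_of_pos hn0 _
  have hs1 : s ≤ 1 := Real.rpow_le_one_of_one_le_of_nonpos hn1 (by norm_num)
  have hs2 : s ^ 2 = (n : ℝ)⁻¹ := by
    rw [hs_def, ← Real.rpow_natCast ((n : ℝ) ^ (-(1 / 2 : ℝ))) 2, ← Real.rpow_mul hn0.le,
      ← Real.rpow_neg_one]
    congr 1
    norm_num
  have e2 : s ^ (-γ) * s ^ 2 = (n : ℝ) ^ (-(1 - γ / 2)) := by
    rw [hs_def, ← Real.rpow_mul hn0.le, ← Real.rpow_natCast ((n : ℝ) ^ (-(1 / 2 : ℝ))) 2,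
      ← Real.rpow_mul hn0.le, ← Real.rpow_add hn0]
    congr 1
    push_cast
    ring
  -- `ε = ε₀ s` and the subcritical parameter `p = p_c - ε`
  set ε : ℝ := ε₀ * s with hε_def
  have hε0 : 0 < ε := mul_pos hε₀pos hs0
  have hεle : ε ≤ ε₀ := by rw [hε_def]; exact mul_le_of_le_one_right hε₀pos.le hs1
  have hp0 : 0 < pc - ε := by linarith
  have hp1 : pc - ε < 1 := by linarith
  set p : unitInterval := ⟨pc - ε, hp0.le, hp1.le⟩ with hp_def
  have hpcoe : (p : ℝ) = pc - ε := rfl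
  -- STUB 3 at `p`
  have hSp := hS p (by rw [hpcoe]; linarith) (by rw [hpcoe]; linarith)
  have hpe : pc - (p : ℝ) = ε := by rw [hpcoe]; ring
  rw [hpe] at hSp
  have hM0 : 0 ≤ C * ε ^ (-γ) := (mul_pos hC (Real.rpow_pos_of_pos hε0 _)).le
  -- STUB 2 at `(p, p_c)` with `M = C ε^{-γ}`
  have hq0 : 0 < ((criticalProbI 3 : unitInterval) : ℝ) := hpc0
  have hq1 : ((criticalProbI 3 : unitInterval) : ℝ) < 1 := hpc1
  have hK2 := h2 p (criticalProbI 3) (by rw [hpcoe]; exact hp0) (by rw [hpcoe]; exact hp1) hq0 hq1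
    (C * ε ^ (-γ)) hM0 hSp n hn
  -- the chi-square bound on the KL price: `kl(p ‖ p_c) ≤ ε² / (p_c (1 - p_c))`
  have hkl : binaryKL (p : ℝ) ((criticalProbI 3 : unitInterval) : ℝ) ≤ ε ^ 2 / (pc * (1 - pc)) := by
    have h := binaryKL_le_sq_div (a := pc - ε) (b := pc) hp0.le hp1.le hpc0 hpc1
    have e : (pc - ε - pc) ^ 2 = ε ^ 2 := by ring
    rw [e] at h
    exact h
  -- assemble
  calc (bondPercolation (halfSpaceGraph 3) (criticalProbI 3)).real (clusterSizeGe (halfSpaceOrigin 3) n)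
      ≤ C * ε ^ (-γ) * (2 / (n : ℝ) + 48 * binaryKL (p : ℝ) ((criticalProbI 3 : unitInterval) : ℝ)) :=
        hK2
    _ ≤ C * ε ^ (-γ) * (2 / (n : ℝ) + 48 * (ε ^ 2 / (pc * (1 - pc)))) :=
        mul_le_mul_of_nonneg_left
          (add_le_add le_rfl (mul_le_mul_of_nonneg_left hkl (by norm_num : (0 : ℝ) ≤ 48))) hM0
    _ = K * (n : ℝ) ^ (-(1 - γ / 2)) := by
        rw [hK_def, ← e2, hε_def, Real.mul_rpow hε₀pos.le hs0.le, div_eq_mul_inv (2 : ℝ) (n : ℝ),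
          ← hs2]
        ring

/-- **STUB 1 ⇒ (any polynomial volume tail on `H` at `p_c` gives the crux)**, same exponent. -/
theorem quantitativeBGNAt_of_surfaceVolumeTail (h1 : ArmToSurfaceTail) (h : SurfaceVolumeTailDecay) :
    QuantitativeBGNAt (criticalProbI 3) := by
  obtain ⟨b, C, hb, hC⟩ := h
  exact ⟨b, C, hb, fun r hr => (h1 (criticalProbI 3) r).trans (hC r hr)⟩

/-- The three statements give the crux at `p_c` (exponent `a = 1 − γ/2`). -/
theorem quantitativeBGNAt_of_transfer (h1 : ArmToSurfaceTail) (h2 : KLSurfaceTail)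
    (h3 : SurfaceGammaSubQuadratic) : QuantitativeBGNAt (criticalProbI 3) :=
  quantitativeBGNAt_of_surfaceVolumeTail h1 (surfaceVolumeTailDecay_of h2 h3)

/-- **`QuantitativeBGN` from the one open stub, BY NAME** (kernel-checked, no `sorry` of its own):
landed STUB 1 (bridge) ∘ [landed STUB 2 (KL on `H` + Markov) + STUB 3 (`γ₁ < 2`, hypothesis) +
`binaryKL_le_sq_div` + the scale choice `ε = ε₀ r^{-1/2}`]. The same implication with the hypothesis
expanded verbatim is landed as `Theorems.quantitativeBGN_of_surfaceGammaSubQuadratic`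
(`Theorems/PercLowPointHalfSpaceQuantitativeBGNKlTransfer.lean`). -/
theorem QuantitativeBGN_of (h3 : Registered.stub_surfaceGammaSubQuadratic) :
    Summit.CriticalPhenomena.PercolationContinuityZ3.Theses.PercLowPointHalfSpace.QuantitativeBGN :=
  -- STUBS 1 and 2 are LANDED theorems (p77770, p79950): discharged here, no longer hypotheses.
  quantitativeBGN_iff.2 (quantitativeBGNAt_of_transfer armToSurfaceTail_holds klSurfaceTail_holds h3)

/-- Wiring check: the one remaining registered stub feeds `QuantitativeBGN_of` as stated. -/
example : Summit.CriticalPhenomena.PercolationContinuityZ3.Theses.PercLowPointHalfSpace.QuantitativeBGN :=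
  QuantitativeBGN_of stub_surfaceGammaSubQuadratic

end Summit.CriticalPhenomena.PercolationContinuityZ3.Cruxes.QuantitativeBGN.KlSurfaceSusceptibilityTransfer

end
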